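import Literature.Analysis.FluidPDE.CompressibleEulerCoefficients
import Literature.Analysis.FluidPDE.CompressibleEulerCoefficientBounds
import Literature.Analysis.FluidPDE.CompressibleEulerResidualBounds
import HarnessLib

/-!
# Uniform pointwise bounds for the coefficients of the symmetrised Euler system on slabs

Analysis/FluidPDE support file (everything proved; no named facts), part of the programme
proving `Literature.Analysis.FluidPDE.CompressibleEulerLocalWellPosedness` (Majda 1984,
Thms 2.1–2.2). The `H³` energy estimate (Majda 1984, Thm 2.2) for a classical solution
`(ρ, u, ϑ)` of the nonisentropic Euler system on `[0, τ] × 𝕋³` uses, besides the commutator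
bounds, SUP BOUNDS of the symmetriser coefficients `a = ϑh'(ρ)/ρ`, `c = ρ`, `d₃ = (3/2)ρ/ϑ`,
`b = ζ(ρ)`, `g = (2/3)ϑζ(ρ)` (`CompressibleEulerCoefficients`), of their first space AND time
derivatives, of `div(a u), div(ρ u), div(d₃ u)` and of `∂ᵢ(aρ), ∂ᵢ(d₃g)` — the quantities entering
the integrated energy identity `linearizedEnergy_hasDerivWithinAt` — in terms of the `C¹` level
`M` of the continuation criterion ONLY (not of `τ` or the solution). `exists_slab_bounds` provides
such constants `C ≥ 1` (third-order coefficient bounds, `CompressibleEulerCoefficientBounds`),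
`δ > 0` (lower bound of the weights) and `B ≥ 0` (everything else), the time derivatives being
computed from the equations (`∂ₜρ = -(u·∇ρ + ρ div u)`, `∂ₜϑ = -(u·∇ϑ + g div u)` and the chain
rule `Torus.timeDerivWithin_comp₂`).

## References

* A. Majda, *Compressible Fluid Flow and Systems of Conservation Laws in Several Space
  Variables*, Springer 1984, Ch. 2 §2.1, Prop. 2.1 and proof of Thm 2.2. [`Majda1984`]
-/

noncomputable section

open Set Function
open scoped ContDiff

namespace Literature.Analysis.FluidPDE

namespace CompressibleEuler

open Literature.Analysis.FunctionSpaces FunctionSpaces.Torus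

variable {ζ f : ℝ → ℝ} {ρm : ℝ}

/-- `|∑ᵢ uᵢ zᵢ| ≤ 3 M A` on `ℝ³` when `‖u‖ ≤ M` and `|zᵢ| ≤ A`. [folklore] -/
theorem abs_sum_coord_mul_le₃ {v : EuclideanSpace ℝ (Fin 3)} {z : Fin 3 → ℝ} {M A : ℝ} (hv : ‖v‖ ≤ M)
    (hz : ∀ i, |z i| ≤ A) : |∑ i, v i * z i| ≤ 3 * (M * A) := by
  have hM : 0 ≤ M := (norm_nonneg _).trans hv
  have h : ∀ i, |v i * z i| ≤ M * A := fun i => by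
    rw [abs_mul]
    exact mul_le_mul ((abs_apply_le_norm' v i).trans hv) (hz i) (abs_nonneg _) hM
  calc |∑ i, v i * z i| ≤ ∑ i, |v i * z i| := Finset.abs_sum_le_sum_abs _ _
    _ ≤ Fintype.card (Fin 3) * (M * A) := sum_le_card_mul h
    _ = 3 * (M * A) := by simp

/-- `|div u| ≤ 3M` on `𝕋³` when `‖∂ᵢu‖ ≤ M`. [folklore] -/
theorem abs_divergence_le₃ {u : UnitAddTorus (Fin 3) → EuclideanSpace ℝ (Fin 3)} (hu : IsSmooth u)
    {x : UnitAddTorus (Fin 3)} {M : ℝ} (hM : ∀ i, ‖partialDeriv i u x‖ ≤ M) :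
    |divergence u x| ≤ 3 * M := by
  have h := (abs_divergence_le_vsize₁ hu x).trans (sum_le_card_mul hM)
  simpa using h

/-- `|div(φ u)| ≤ 6 C M` on `𝕋³` when `|φ|, |∂ᵢφ| ≤ C`, `‖u‖ ≤ M`, `‖∂ᵢu‖ ≤ M`. [folklore] -/
theorem abs_divergence_smul_le₃ {φ : UnitAddTorus (Fin 3) → ℝ} {u : UnitAddTorus (Fin 3) → EuclideanSpace ℝ (Fin 3)}
    (hφ : IsSmooth φ) (hu : IsSmooth u) {x : UnitAddTorus (Fin 3)} {C M : ℝ} (h0 : |φ x| ≤ C)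
    (h1 : ∀ i, |partialDeriv i φ x| ≤ C) (hM : ‖u x‖ ≤ M) (hM' : ∀ i, ‖partialDeriv i u x‖ ≤ M) :
    |divergence (fun y => φ y • u y) x| ≤ 6 * (C * M) := by
  rw [Torus.divergence_smul (hφ.isContDiff (by simp)) (hu.isContDiff (by simp))]
  have hA : |φ x * divergence u x| ≤ C * (3 * M) := by
    rw [abs_mul]
    exact mul_le_mul h0 (abs_divergence_le₃ hu hM') (abs_nonneg _) ((abs_nonneg _).trans h0)
  have hB : |∑ i, u x i * partialDeriv i φ x| ≤ 3 * (M * C) := abs_sum_coord_mul_le₃ hM h1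
  calc _ ≤ |φ x * divergence u x| + |∑ i, u x i * partialDeriv i φ x| := abs_add_le _ _
    _ ≤ C * (3 * M) + 3 * (M * C) := add_le_add hA hB
    _ = 6 * (C * M) := by ring

/-- **Uniform slab bounds for the symmetriser coefficients.** Given the constitutive function `ζ`
(`(sζ)' > 0` on `(0, ρ̄)`), a `C¹` level `M > 0` and a density ceiling `ρ̄₁ < ρ̄`, there are
constants `C ≥ 1`, `δ > 0`, `B ≥ 0` such that for EVERY smooth solution of the primitive Euler
system of the athermal monatomic law on a slab `[0, τ] × 𝕋³` obeying the bounds of the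
continuation criterion at level `M` (`M⁻¹ ≤ ρ ≤ ρ̄₁`, `M⁻¹ ≤ ϑ ≤ M`, `‖u‖, |∂ρ|, ‖∂u‖, |∂ϑ| ≤ M`),
at every point of the slab: the coefficients `a, b, g` have third-order derivative bounds `C`
(relative to the second/third derivative sizes of `(ρ, ϑ)`); the weights satisfy
`δ ≤ a, ρ, d₃ ≤ B`; and `|∂ₜa|, |∂ₜρ|, |∂ₜd₃|`, `|div(a u)|, |div(ρ u)|, |div(d₃ u)|`,
`|∂ᵢ(aρ)|, |∂ᵢ(d₃ g)|` are all `≤ B` (Majda 1984, Ch. 2 §2.1: the constants of the energy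
estimate depend on the solution only through its `C¹` norm and the distance of its range to the
boundary of the state space). [cite: Majda1984, Ch. 2 §2.1 Prop. 2.1, proof of Thm 2.2] -/
theorem exists_slab_bounds (hζ : ContDiff ℝ ∞ ζ) (hζ' : ∀ r ∈ Ioo 0 ρm, 0 < deriv (fun s : ℝ => s * ζ s) r)
    {M ρ₁ : ℝ} (hM : 0 < M) (hρ₁ : ρ₁ < ρm) :
    ∃ C δ B : ℝ, 1 ≤ C ∧ 0 < δ ∧ 0 ≤ B ∧
      ∀ ⦃τ : ℝ⦄, 0 < τ → ∀ ⦃ρ ϑ : ℝ → UnitAddTorus (Fin 3) → ℝ⦄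
        ⦃u : ℝ → UnitAddTorus (Fin 3) → EuclideanSpace ℝ (Fin 3)⦄,
        IsPrimitiveEulerSolutionOn (EulerEOS.monatomicExcess ζ f) (Icc 0 τ) ρ u ϑ →
        (∀ s ∈ Icc 0 τ, ∀ x, M⁻¹ ≤ ρ s x ∧ ρ s x ≤ ρ₁ ∧ M⁻¹ ≤ ϑ s x ∧ ϑ s x ≤ M ∧ ‖u s x‖ ≤ M ∧
          ∀ i, |partialDeriv i (ρ s) x| ≤ M ∧ ‖partialDeriv i (u s) x‖ ≤ M ∧ |partialDeriv i (ϑ s) x| ≤ M) →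
        ∀ s ∈ Icc 0 τ, ∀ x,
          (HasDerivBoundsAt₃ (coefA ζ ρ ϑ s) x C (dsize₂ (ρ s) x + dsize₂ (ϑ s) x) (dsize₃ (ρ s) x + dsize₃ (ϑ s) x) ∧
            HasDerivBoundsAt₃ (coefB ζ ρ s) x C (dsize₂ (ρ s) x + dsize₂ (ϑ s) x) (dsize₃ (ρ s) x + dsize₃ (ϑ s) x) ∧
            HasDerivBoundsAt₃ (coefG ζ ρ ϑ s) x C (dsize₂ (ρ s) x + dsize₂ (ϑ s) x)
              (dsize₃ (ρ s) x + dsize₃ (ϑ s) x)) ∧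
          (δ ≤ coefA ζ ρ ϑ s x ∧ coefA ζ ρ ϑ s x ≤ B ∧ δ ≤ ρ s x ∧ ρ s x ≤ B ∧
            δ ≤ coefD ρ ϑ s x ∧ coefD ρ ϑ s x ≤ B) ∧
          (|timeDerivWithin (Icc 0 τ) (coefA ζ ρ ϑ) s x| ≤ B ∧ |timeDerivWithin (Icc 0 τ) ρ s x| ≤ B ∧
            |timeDerivWithin (Icc 0 τ) (coefD ρ ϑ) s x| ≤ B) ∧
          (|divergence (fun y => coefA ζ ρ ϑ s y • u s y) x| ≤ B ∧
            |divergence (fun y => ρ s y • u s y) x| ≤ B ∧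
            |divergence (fun y => coefD ρ ϑ s y • u s y) x| ≤ B) ∧
          (∀ i, |partialDeriv i (fun y => coefA ζ ρ ϑ s y * ρ s y) x| ≤ B ∧
            |partialDeriv i (fun y => coefD ρ ϑ s y * coefG ζ ρ ϑ s y) x| ≤ B) := by
  have hm : (0 : ℝ) < M⁻¹ := inv_pos.2 hM
  obtain ⟨C, δ, hC, hδ, H⟩ := exists_coefficient_bounds (d := Fin 3) (Θ := M) hζ hζ' hm hρ₁ hM.le
  set kf : ℝ → ℝ := fun s => deriv (fun r : ℝ => r * ζ r) s / s with hkf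
  have hk : ContDiffOn ℝ ∞ kf (Ioi 0) := contDiffOn_kfun hζ
  have hI : Icc M⁻¹ ρ₁ ⊆ Ioi (0 : ℝ) := fun s hs => hm.trans_le hs.1
  obtain ⟨Kk, hKk0, hKk⟩ := exists_bound_derivs₃ hk isOpen_Ioi hI
  have hC0 : 0 ≤ C := by linarith
  -- the constants
  set B₁ : ℝ := 3 * (M * M) + C * (3 * M) with hB₁
  set B₃ : ℝ := C * Kk * B₁ + Kk * B₁ with hB₃
  set B₄ : ℝ := 3 / 2 * (M * B₁) + 3 / 2 * (C * (M * M) * B₁) with hB₄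
  set Bd : ℝ := 6 * (C * M) with hBd
  set Bp : ℝ := C * C + C * C with hBp
  have hB₁0 : 0 ≤ B₁ := by positivity
  have hB₃0 : 0 ≤ B₃ := by positivity
  have hB₄0 : 0 ≤ B₄ := by positivity
  have hBd0 : 0 ≤ Bd := by positivity
  have hBp0 : 0 ≤ Bp := by positivity
  set B : ℝ := C + B₁ + B₃ + B₄ + Bd + Bp with hB
  refine ⟨C, δ, B, hC, hδ, by positivity, ?_⟩
  intro τ hτ ρ ϑ u h hb s hs x
  have hU : UniqueDiffOn ℝ (Icc 0 τ) := uniqueDiffOn_Icc hτ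
  have hρs := h.smooth_density.isSmooth_slice hs
  have hϑs := h.smooth_temperature.isSmooth_slice hs
  have hus := h.smooth_velocity.isSmooth_slice hs
  -- the coefficient bounds at time `s`
  have Hs := H (ρ s) (ϑ s) hρs hϑs (fun y => ⟨(hb s hs y).1, (hb s hs y).2.1, (hb s hs y).2.2.1, (hb s hs y).2.2.2.1⟩)
    (fun y i => ⟨((hb s hs y).2.2.2.2.2 i).1, ((hb s hs y).2.2.2.2.2 i).2.2⟩)
  obtain ⟨Ha, Hb', Hρ, Hg, Hd, Hϑ, δa, δρ, δd⟩ := Hs x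
  obtain ⟨hρlo, hρhi, hϑlo, hϑhi, huM, hDM⟩ := hb s hs x
  have hρ0 : 0 < ρ s x := hm.trans_le hρlo
  have hϑ0 : 0 < ϑ s x := hm.trans_le hϑlo
  have hρI : ρ s x ∈ Icc M⁻¹ ρ₁ := ⟨hρlo, hρhi⟩
  have aρ : |ρ s x| ≤ C := Hρ.zero
  have aϑ : |ϑ s x| ≤ C := Hϑ.zero
  have aa : |coefA ζ ρ ϑ s x| ≤ C := Ha.zero
  have ad : |coefD ρ ϑ s x| ≤ C := Hd.zero
  have ag : |coefG ζ ρ ϑ s x| ≤ C := Hg.zero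
  have hϑinv : (ϑ s x)⁻¹ ≤ M := by
    have := inv_anti₀ hm hϑlo
    rwa [inv_inv] at this
  have hdiv : |divergence (u s) x| ≤ 3 * M := abs_divergence_le₃ hus fun i => (hDM i).2.1
  -- time derivatives from the equations
  have tρ : timeDerivWithin (Icc 0 τ) ρ s x =
      -((∑ i, u s x i * partialDeriv i (ρ s) x) + ρ s x * divergence (u s) x) := by
    linarith [h.continuity s hs x]
  have tϑ : timeDerivWithin (Icc 0 τ) ϑ s x =
      -((∑ i, u s x i * partialDeriv i (ϑ s) x) + coefG ζ ρ ϑ s x * divergence (u s) x) := by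
    have := h.temperature_eq hU hs x
    simp only [coefG]
    linarith
  have bρ : |timeDerivWithin (Icc 0 τ) ρ s x| ≤ B₁ := by
    rw [tρ, abs_neg]
    have h1 : |∑ i, u s x i * partialDeriv i (ρ s) x| ≤ 3 * (M * M) := abs_sum_coord_mul_le₃ huM fun i => (hDM i).1
    have h2 : |ρ s x * divergence (u s) x| ≤ C * (3 * M) := by
      rw [abs_mul]; exact mul_le_mul aρ hdiv (abs_nonneg _) hC0
    exact (abs_add_le _ _).trans (by rw [hB₁]; exact add_le_add h1 h2)
  have bϑ : |timeDerivWithin (Icc 0 τ) ϑ s x| ≤ B₁ := by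
    rw [tϑ, abs_neg]
    have h1 : |∑ i, u s x i * partialDeriv i (ϑ s) x| ≤ 3 * (M * M) :=
      abs_sum_coord_mul_le₃ huM fun i => (hDM i).2.2
    have h2 : |coefG ζ ρ ϑ s x * divergence (u s) x| ≤ C * (3 * M) := by
      rw [abs_mul]; exact mul_le_mul ag hdiv (abs_nonneg _) hC0
    exact (abs_add_le _ _).trans (by rw [hB₁]; exact add_le_add h1 h2)
  -- `∂ₜ a` by the chain rule
  have ba : |timeDerivWithin (Icc 0 τ) (coefA ζ ρ ϑ) s x| ≤ B₃ := by
    have hg2 : ContDiffOn ℝ 1 (uncurry fun (r θ : ℝ) => θ * kf r) (Ioi 0 ×ˢ univ) := by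
      have e : (uncurry fun (r θ : ℝ) => θ * kf r) = fun p : ℝ × ℝ => p.2 * kf p.1 := by
        funext p; rfl
      rw [e]
      exact contDiffOn_snd.mul ((hk.of_le (by simp)).comp contDiffOn_fst fun p hp => hp.1)
    have hx : (ρ s x, ϑ s x) ∈ Ioi (0 : ℝ) ×ˢ (univ : Set ℝ) := ⟨hρ0, mem_univ _⟩
    have hcomp := timeDerivWithin_comp₂ (g := fun (r θ : ℝ) => θ * kf r) hg2 (isOpen_Ioi.prod isOpen_univ) le_rfl
      h.smooth_density h.smooth_temperature hU hs x hx
    have e0 : timeDerivWithin (Icc 0 τ) (coefA ζ ρ ϑ) s x =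
        timeDerivWithin (Icc 0 τ) (fun s' y => (fun (r θ : ℝ) => θ * kf r) (ρ s' y) (ϑ s' y)) s x := rfl
    have hkd : DifferentiableAt ℝ kf (ρ s x) :=
      (hk.differentiableOn (by simp)).differentiableAt (Ioi_mem_nhds hρ0)
    have d1 : deriv (fun r => ϑ s x * kf r) (ρ s x) = ϑ s x * deriv kf (ρ s x) :=
      (hkd.hasDerivAt.const_mul (ϑ s x)).deriv
    have d2 : deriv (fun θ => θ * kf (ρ s x)) (ϑ s x) = kf (ρ s x) := by
      rw [((hasDerivAt_id' (ϑ s x)).mul_const (kf (ρ s x))).deriv, one_mul]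
    rw [e0, hcomp, d1, d2]
    obtain ⟨k0, k1, -, -⟩ := hKk _ hρI
    have h1 : |ϑ s x * deriv kf (ρ s x) * timeDerivWithin (Icc 0 τ) ρ s x| ≤ C * Kk * B₁ := by
      rw [abs_mul, abs_mul]
      exact mul_le_mul (mul_le_mul aϑ k1 (abs_nonneg _) hC0) bρ (abs_nonneg _) (by positivity)
    have h2 : |kf (ρ s x) * timeDerivWithin (Icc 0 τ) ϑ s x| ≤ Kk * B₁ := by
      rw [abs_mul]; exact mul_le_mul k0 bϑ (abs_nonneg _) hKk0
    exact (abs_add_le _ _).trans (by rw [hB₃]; exact add_le_add h1 h2)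
  -- `∂ₜ d₃` by the chain rule
  have bd : |timeDerivWithin (Icc 0 τ) (coefD ρ ϑ) s x| ≤ B₄ := by
    have hg2 : ContDiffOn ℝ 1 (uncurry fun (r θ : ℝ) => 3 / 2 * (r * θ⁻¹)) (univ ×ˢ Ioi 0) := by
      have e : (uncurry fun (r θ : ℝ) => 3 / 2 * (r * θ⁻¹)) = fun p : ℝ × ℝ => 3 / 2 * (p.1 * p.2⁻¹) := by
        funext p; rfl
      rw [e]
      exact contDiffOn_const.mul (contDiffOn_fst.mul (contDiffOn_snd.inv fun p hp => ne_of_gt hp.2))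
    have hx : (ρ s x, ϑ s x) ∈ (univ : Set ℝ) ×ˢ Ioi (0 : ℝ) := ⟨mem_univ _, hϑ0⟩
    have hcomp := timeDerivWithin_comp₂ (g := fun (r θ : ℝ) => 3 / 2 * (r * θ⁻¹)) hg2 (isOpen_univ.prod isOpen_Ioi)
      le_rfl h.smooth_density h.smooth_temperature hU hs x hx
    have e0 : timeDerivWithin (Icc 0 τ) (coefD ρ ϑ) s x =
        timeDerivWithin (Icc 0 τ) (fun s' y => (fun (r θ : ℝ) => 3 / 2 * (r * θ⁻¹)) (ρ s' y) (ϑ s' y)) s x := rfl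
    have d1 : deriv (fun r => 3 / 2 * (r * (ϑ s x)⁻¹)) (ρ s x) = 3 / 2 * (1 * (ϑ s x)⁻¹) :=
      (((hasDerivAt_id (ρ s x)).mul_const (ϑ s x)⁻¹).const_mul (3 / 2)).deriv
    have d2 : deriv (fun θ => 3 / 2 * (ρ s x * θ⁻¹)) (ϑ s x) = 3 / 2 * (ρ s x * (-((ϑ s x) ^ 2)⁻¹)) :=
      (((hasDerivAt_inv hϑ0.ne').const_mul (ρ s x)).const_mul (3 / 2)).deriv
    rw [e0, hcomp, d1, d2]
    have hinv2 : |(-((ϑ s x) ^ 2)⁻¹)| ≤ M * M := by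
      rw [abs_neg, abs_inv, abs_pow, abs_of_pos hϑ0, ← inv_pow, sq]
      exact mul_le_mul hϑinv hϑinv (inv_nonneg.2 hϑ0.le) hM.le
    have h1 : |3 / 2 * (1 * (ϑ s x)⁻¹) * timeDerivWithin (Icc 0 τ) ρ s x| ≤ 3 / 2 * (M * B₁) := by
      rw [one_mul, abs_mul, abs_mul, abs_of_pos (by norm_num : (0:ℝ) < 3 / 2), abs_inv, abs_of_pos hϑ0, mul_assoc]
      exact mul_le_mul_of_nonneg_left (mul_le_mul hϑinv bρ (abs_nonneg _) hM.le) (by norm_num)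
    have h2 : |3 / 2 * (ρ s x * -((ϑ s x) ^ 2)⁻¹) * timeDerivWithin (Icc 0 τ) ϑ s x| ≤ 3 / 2 * (C * (M * M) * B₁) := by
      rw [abs_mul, abs_mul, abs_mul, abs_of_pos (by norm_num : (0:ℝ) < 3 / 2), mul_assoc]
      refine mul_le_mul_of_nonneg_left ?_ (by norm_num)
      exact mul_le_mul (mul_le_mul aρ hinv2 (abs_nonneg _) hC0) bϑ (abs_nonneg _) (by positivity)
    exact (abs_add_le _ _).trans (by rw [hB₄]; exact add_le_add h1 h2)
  -- divergences and products
  have hAs : IsSmooth (coefA ζ ρ ϑ s) := (isSmoothSpaceTimeOn_coefA hζ h).isSmooth_slice hs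
  have hDs : IsSmooth (coefD ρ ϑ s) := (isSmoothSpaceTimeOn_coefD h).isSmooth_slice hs
  have hGs : IsSmooth (coefG ζ ρ ϑ s) := (isSmoothSpaceTimeOn_coefG hζ h).isSmooth_slice hs
  have huM' : ∀ i, ‖partialDeriv i (u s) x‖ ≤ M := fun i => (hDM i).2.1
  have dva : |divergence (fun y => coefA ζ ρ ϑ s y • u s y) x| ≤ Bd :=
    abs_divergence_smul_le₃ hAs hus aa Ha.one huM huM'
  have dvρ : |divergence (fun y => ρ s y • u s y) x| ≤ Bd :=
    abs_divergence_smul_le₃ hρs hus aρ Hρ.one huM huM'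
  have dvd : |divergence (fun y => coefD ρ ϑ s y • u s y) x| ≤ Bd :=
    abs_divergence_smul_le₃ hDs hus ad Hd.one huM huM'
  have paρ : ∀ i, |partialDeriv i (fun y => coefA ζ ρ ϑ s y * ρ s y) x| ≤ Bp := fun i =>
    abs_partialDeriv_mul_le₁ hAs hρs aa Ha.one aρ Hρ.one i
  have pdg : ∀ i, |partialDeriv i (fun y => coefD ρ ϑ s y * coefG ζ ρ ϑ s y) x| ≤ Bp := fun i =>
    abs_partialDeriv_mul_le₁ hDs hGs ad Hd.one ag Hg.one i
  -- compare with `B`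
  have leB : ∀ {y K : ℝ}, y ≤ K → 0 ≤ K → K ≤ B → y ≤ B := fun h _ hK => h.trans hK
  have cB : C ≤ B := by rw [hB]; linarith
  have c1 : B₁ ≤ B := by rw [hB]; linarith
  have c3 : B₃ ≤ B := by rw [hB]; linarith
  have c4 : B₄ ≤ B := by rw [hB]; linarith
  have cd : Bd ≤ B := by rw [hB]; linarith
  have cp : Bp ≤ B := by rw [hB]; linarith
  refine ⟨⟨Ha, Hb', Hg⟩, ⟨δa, (le_abs_self _).trans (aa.trans cB), δρ, (le_abs_self _).trans (aρ.trans cB), δd,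
    (le_abs_self _).trans (ad.trans cB)⟩, ⟨ba.trans c3, bρ.trans c1, bd.trans c4⟩,
    ⟨dva.trans cd, dvρ.trans cd, dvd.trans cd⟩, fun i => ⟨(paρ i).trans cp, (pdg i).trans cp⟩⟩

end CompressibleEuler

end Literature.Analysis.FluidPDE

end
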